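import Mathlib
import Summits.NavierStokesRegularity.NavierStokesRegularity.Theorems.EulerZoomLiouvillePowerGaugeEulerLiouvilleCompactVortexEnergySlaving
import Summits.NavierStokesRegularity.NavierStokesRegularity.Theorems.EulerZoomLiouvillePowerGaugeEulerLiouvilleVorticitySupportConservation
import Summits.NavierStokesRegularity.NavierStokesRegularity.Theorems.EulerZoomLiouvillePowerGaugeEulerLiouvilleAllRhoStrata
import HarnessLib

/-!
# ENSTROPHY STARVATION: classical confined-vortex members of the power-gauged class are trivial
# (crux `EulerZoomLiouville.PowerGaugeEulerLiouville` = stmt-NavierStokesRegularity-19832; line `vortex-volume` of ns-idea-11, stub V3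
# `stub_starvedVortexEndgame` — THE CORE of the line, filler)

Route `EulerZoomLiouville` (NavierStokesRegularity); width seat ns-ezl-w1 on the interim LEAD ns-typeII-p2 g10's assignment (V2 → V1 → V1b → V3).
A CLASSICAL member of Seregin's power-gauged ancient Euler class (exponent `ρ > 0`) whose vorticity slices are CONFINED,
`supp curl u(τ) ⊆ B(0, κ(1+|τ|)^β)` with `β(1−ρ) < 1`, whose slices are their Biot–Savart fields (V1) and which has slab bounds (V1b), vanishes
— given the volume-slaving inequality (V2):

1. VORTEX VOLUME IS CONSTANT in the past (`volume_vorticitySupport_eq`: Helmholtz, tree `VorticitySupport.volume_vorticitySupport_eq_of_classical`,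
   fed with the slab bounds and the confinement ball), `V₀ = vol{curl u(τ) ≠ 0} < ∞`;
2. WINDOW SLAVING (`CompactVortex.lintegral_window_energy_le`): `∫_{−a²}^{0}∫|u(τ)|² dτ ≤ C V₀^{2/3}‖curlCLM‖² · c b'^{1−ρ}` with
   `b' = (1 + κ2^β) a^{max(1,2β)} ≥ κ(1+a²)^β, a`;
3. STARVATION: `b'^{1−ρ}/a² ≲ a^{max(1,2β)·max(1−ρ,0) − 2} → 0` exactly because `β(1−ρ) < 1`, so by Chebyshev in time the set of
   `τ ∈ (−a², −a²/2)` with `∫|u(τ)|² ≤ ε` has positive measure for every `ε > 0` and all large `a`: the past is ENERGY-QUIESCENT and the crux's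
   filled stratum `ae_eq_zero_of_gauge_of_energyVanishing_allRho` (no energy creation) gives `u = 0` a.e.

Main theorem `CompactVortex.ae_eq_zero_of_gauge_of_confinedVortex` = the line's `Sig.stub_starvedVortexEndgame` with `InClass`, `IsConfinedVortex`,
`HasSlabBounds`, `VortexVolumeEnergyIneq`, `VanishesAE` unfolded (binders verbatim).  WHAT THIS IS NOT: not NS, not E — one classical stratum
of crux E `--supports` stmt-19832 (V4 runaway supports and V5 the diffuse residue stay open). [folklore]
-/

noncomputable section

-- flat `Theorems/<Route><Decl>…` files of one crux share the namespace of the crux (tree convention: `Summit.<S>.<S>.…`)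
set_option linter.dupNamespace false

open MeasureTheory Set Filter Topology Metric Function TopologicalSpace
open scoped ENNReal NNReal ContDiff

namespace Summit.NavierStokesRegularity.NavierStokesRegularity.Theorems.PowerGaugeEulerLiouville

open Literature.Analysis Literature.Analysis.FunctionSpaces Literature.Analysis.FluidPDE

namespace CompactVortex

/-! ### The vortex volume of a confined classical member is constant -/

/-- **The vortex volume is constant in the past** (Helmholtz): for a classical member with confined vorticity slices and slab bounds,
`vol{curl u(τ₂) ≠ 0} = vol{curl u(τ₁) ≠ 0}` for `τ₁ < τ₂ < 0` (tree `VorticitySupport.volume_vorticitySupport_eq_of_classical`; the uniform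
volume bound on `[τ₁, τ₂]` is the volume of the confinement ball at time `τ₁`). [folklore] -/
theorem volume_vorticitySupport_eq
    {u : ℝ → EuclideanSpace ℝ (Fin 3) → EuclideanSpace ℝ (Fin 3)} {p : ℝ → EuclideanSpace ℝ (Fin 3) → ℝ}
    (hcl : IsClassicalEulerSolutionOn (Iio 0) 0 u p) {κ β : ℝ} (hκ : 0 < κ) (hβ : 0 ≤ β)
    (hsupp : ∀ τ : ℝ, τ < 0 → Function.support (curl (u τ)) ⊆ ball (0 : EuclideanSpace ℝ (Fin 3)) (κ * (1 + |τ|) ^ β))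
    (hSB : ∀ s t : ℝ, s < t → t < 0 → ∃ B : ℝ, ∀ τ ∈ Icc s t, ∀ y : EuclideanSpace ℝ (Fin 3),
      ‖u τ y‖ ≤ B ∧ ‖fderiv ℝ (u τ) y‖ ≤ B)
    {τ₁ τ₂ : ℝ} (h12 : τ₁ < τ₂) (hτ₂ : τ₂ < 0) :
    volume (Function.support (curl (u τ₂))) = volume (Function.support (curl (u τ₁))) := by
  obtain ⟨B, hB⟩ := hSB τ₁ τ₂ h12 hτ₂
  set R : ℝ := κ * (1 + |τ₁|) ^ β with hR
  have hN : ∀ τ ∈ Icc τ₁ τ₂, volume {y | curl (u τ) y ≠ 0} ≤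
      ((volume (ball (0 : EuclideanSpace ℝ (Fin 3)) R)).toNNReal : ℝ≥0∞) := by
    intro τ hτ
    have hτ0 : τ < 0 := lt_of_le_of_lt hτ.2 hτ₂
    have hτ10 : τ₁ < 0 := h12.trans hτ₂
    have hrad : κ * (1 + |τ|) ^ β ≤ R := by
      have h1 : |τ| ≤ |τ₁| := by
        rw [abs_of_neg hτ0, abs_of_neg hτ10]; linarith [hτ.1]
      rw [hR]
      exact mul_le_mul_of_nonneg_left (Real.rpow_le_rpow (by positivity) (by linarith) hβ) hκ.le
    rw [ENNReal.coe_toNNReal measure_ball_lt_top.ne]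
    exact measure_mono ((hsupp τ hτ0).trans (ball_subset_ball hrad))
  exact VorticitySupport.volume_vorticitySupport_eq_of_classical hcl h12 hτ₂ hB hN

/-! ### The starvation endgame -/

set_option maxHeartbeats 400000 in
/-- **CLASSICAL CONFINED-VORTEX MEMBERS OF THE POWER-GAUGED CLASS ARE TRIVIAL** (`Sig.stub_starvedVortexEndgame` of the line `vortex-volume`,
unfolded; crux hypotheses verbatim, any `ρ > 0`): a suitable weak ancient Euler pair `(u, p)` on `(−∞,0) × ℝ³` with weak gradient `H` and
the three power gauges, which is CLASSICAL on the open slab, whose vorticity slices satisfy `supp curl u(τ) ⊆ B(0, κ(1+|τ|)^β)` (`κ > 0`,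
`β ≥ 0`, `β(1−ρ) < 1`), whose slices are their Biot–Savart fields and which has slab bounds, vanishes a.e. on the slab — given the
volume-slaving inequality with some constant `C`.  See the module docstring for the mechanism (constant vortex volume, window slaving,
Chebyshev in time, energy-quiescent past). [folklore] -/
theorem ae_eq_zero_of_gauge_of_confinedVortex {ρ : ℝ} (hρ : 0 < ρ)
    {u : ℝ → EuclideanSpace ℝ (Fin 3) → EuclideanSpace ℝ (Fin 3)} {p : ℝ → EuclideanSpace ℝ (Fin 3) → ℝ}
    {H : ℝ → EuclideanSpace ℝ (Fin 3) → EuclideanSpace ℝ (Fin 3) →L[ℝ] EuclideanSpace ℝ (Fin 3)} {c : ℝ≥0}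
    (hsw : IsSuitableWeakSolutionOn (slab (EuclideanSpace ℝ (Fin 3)) (Iio 0) isOpen_Iio) 0 0 u p)
    (hH : HasWeakSpatialGradientOn (slab (EuclideanSpace ℝ (Fin 3)) (Iio 0) isOpen_Iio) u H)
    (hgauge : ∀ a : ℝ, 0 < a →
      ENNReal.ofReal (a ^ (2 * ρ)) * cknA a (0 : ℝ × EuclideanSpace ℝ (Fin 3)) u +
          ENNReal.ofReal (a ^ ρ) * cknE a (0 : ℝ × EuclideanSpace ℝ (Fin 3)) H +
        ENNReal.ofReal (a ^ (2 * ρ)) * cknD a (0 : ℝ × EuclideanSpace ℝ (Fin 3)) p ≤ (c : ℝ≥0∞))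
    (hcl : IsClassicalEulerSolutionOn (Iio 0) 0 u p)
    {κ β : ℝ} (hκ : 0 < κ) (hβ : 0 ≤ β) (hβρ : β * (1 - ρ) < 1)
    (hsupp : ∀ τ : ℝ, τ < 0 → Function.support (curl (u τ)) ⊆ ball (0 : EuclideanSpace ℝ (Fin 3)) (κ * (1 + |τ|) ^ β))
    (hrepr : ∀ τ : ℝ, τ < 0 → u τ = biotSavart (curl (u τ)))
    (hSB : ∀ s t : ℝ, s < t → t < 0 → ∃ B : ℝ, ∀ τ ∈ Icc s t, ∀ y : EuclideanSpace ℝ (Fin 3),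
      ‖u τ y‖ ≤ B ∧ ‖fderiv ℝ (u τ) y‖ ≤ B)
    {C : ℝ≥0}
    (hC : ∀ W : EuclideanSpace ℝ (Fin 3) → EuclideanSpace ℝ (Fin 3), Continuous W → HasCompactSupport W →
      ∫⁻ x, ‖biotSavart W x‖ₑ ^ 2 ≤
        (C : ℝ≥0∞) * volume (Function.support W) ^ (2 / 3 : ℝ) * ∫⁻ x, ‖W x‖ₑ ^ 2) :
    uncurry u =ᵐ[volume.restrict (Iio (0 : ℝ) ×ˢ (univ : Set (EuclideanSpace ℝ (Fin 3))))] 0 := by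
  have hE : ∀ a : ℝ, 0 < a → ENNReal.ofReal (a ^ ρ) *
      cknE a (0 : ℝ × EuclideanSpace ℝ (Fin 3)) H ≤ (c : ℝ≥0∞) :=
    fun a ha => le_trans (le_trans le_add_self le_self_add) (hgauge a ha)
  -- ### compact support of the vorticity slices
  have hωc : ∀ τ : ℝ, τ < 0 → HasCompactSupport (curl (u τ)) := fun τ hτ =>
    IsCompact.of_isClosed_subset (isCompact_closedBall (0 : EuclideanSpace ℝ (Fin 3)) _) (isClosed_tsupport _)
      (closure_minimal ((hsupp τ hτ).trans ball_subset_closedBall) isClosed_closedBall)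
  -- ### the constant vortex volume `V₀`
  set V₀ : ℝ≥0∞ := volume (Function.support (curl (u (-1)))) with hV₀
  have hV₀t : V₀ ≠ ⊤ :=
    (lt_of_le_of_lt (measure_mono (hsupp (-1) (by norm_num))) measure_ball_lt_top).ne
  have hvolτ : ∀ τ : ℝ, τ < 0 → volume (Function.support (curl (u τ))) = V₀ := by
    intro τ hτ
    rcases lt_trichotomy τ (-1) with h | h | h
    · exact (volume_vorticitySupport_eq hcl hκ hβ hsupp hSB h (by norm_num)).symm
    · rw [h]
    · exact volume_vorticitySupport_eq hcl hκ hβ hsupp hSB h hτ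
  -- ### measurability of the slice energy `F`
  have hum : AEStronglyMeasurable (uncurry u)
      (volume.restrict (Iio (0 : ℝ) ×ˢ (univ : Set (EuclideanSpace ℝ (Fin 3))))) := by
    have := hH.locallyIntegrableOn.aestronglyMeasurable
    simpa [slab] using this
  -- ### exponents
  set m : ℝ := max 1 (2 * β) with hm
  set θ : ℝ := max (1 - ρ) 0 with hθ
  have hm1 : 1 ≤ m := le_max_left _ _
  have hθ0 : 0 ≤ θ := le_max_right _ _
  have hexp : m * θ < 2 := by
    rcases le_or_gt (1 - ρ) 0 with hρ1 | hρ1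
    · have : θ = 0 := by rw [hθ, max_eq_right hρ1]
      rw [this, mul_zero]; norm_num
    · have hθ' : θ = 1 - ρ := by rw [hθ, max_eq_left hρ1.le]
      rw [hθ']
      rcases le_or_gt 1 (2 * β) with hb | hb
      · rw [hm, max_eq_right hb]; nlinarith
      · rw [hm, max_eq_left hb.le]; linarith
  set L : ℝ := 1 + κ * (2 : ℝ) ^ β with hL
  have hκ2 : 0 ≤ κ * (2 : ℝ) ^ β := by positivity
  have hL1 : 1 ≤ L := by rw [hL]; linarith
  have hL0 : 0 < L := by linarith
  -- the constant of the window bound (finite)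
  set K₁ : ℝ≥0∞ := (C : ℝ≥0∞) * V₀ ^ (2 / 3 : ℝ) * ENNReal.ofReal (‖curlCLM‖ ^ 2) with hK₁
  have hK₁t : K₁ ≠ ⊤ := ENNReal.mul_ne_top
    (ENNReal.mul_ne_top ENNReal.coe_ne_top (ENNReal.rpow_ne_top_of_nonneg (by norm_num) hV₀t)) ENNReal.ofReal_ne_top
  set k₁ : ℝ := K₁.toReal with hk₁
  have hk₁0 : 0 ≤ k₁ := ENNReal.toReal_nonneg
  -- ### the energy-quiescent past
  refine ae_eq_zero_of_gauge_of_energyVanishing_allRho hρ.le hsw hH hgauge fun ε hε N => ?_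
  -- choose the scale `a`
  have htend : Tendsto (fun a : ℝ => k₁ * ((c : ℝ) * L ^ θ) * a ^ (m * θ - 2)) atTop (𝓝 (k₁ * ((c : ℝ) * L ^ θ) * 0)) := by
    refine tendsto_const_nhds.mul ?_
    have := tendsto_rpow_neg_atTop (y := 2 - m * θ) (by linarith)
    simpa [show -(2 - m * θ) = m * θ - 2 by ring] using this
  rw [mul_zero] at htend
  have hε4 : (0 : ℝ) < ε / 4 := by positivity
  obtain ⟨a, haε, hage⟩ := ((htend.eventually (gt_mem_nhds hε4)).and
    (eventually_ge_atTop (max (2 * max N 0 + 1) 1))).exists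
  have ha1 : 1 ≤ a := (le_max_right _ _).trans hage
  have ha0 : 0 < a := by linarith
  have haN : 2 * max N 0 + 1 ≤ a := (le_max_left _ _).trans hage
  have ha2N : N ≤ a ^ 2 / 2 := by nlinarith [le_max_left N 0, le_max_right N 0]
  -- ### radii: confinement radius `b` on the window `(−a², 0)` and `b' = L a^m`
  set b : ℝ := κ * (1 + a ^ 2) ^ β with hb
  set b' : ℝ := L * a ^ m with hb'
  have ham : a ≤ a ^ m := by
    calc a = a ^ (1 : ℝ) := (Real.rpow_one a).symm
      _ ≤ a ^ m := Real.rpow_le_rpow_of_exponent_le ha1 hm1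
  have hb'a : a ≤ b' := by
    calc a ≤ a ^ m := ham
      _ = 1 * a ^ m := (one_mul _).symm
      _ ≤ L * a ^ m := mul_le_mul_of_nonneg_right hL1 (by positivity)
  have hb'0 : 0 < b' := lt_of_lt_of_le ha0 hb'a
  have hb'1 : 1 ≤ b' := ha1.trans hb'a
  have hbb' : b ≤ b' := by
    have h1 : (1 + a ^ 2) ^ β ≤ (2 : ℝ) ^ β * a ^ (2 * β) := by
      rw [Real.rpow_mul ha0.le, ← Real.mul_rpow (by norm_num) (by positivity)]
      exact Real.rpow_le_rpow (by positivity) (by rw [Real.rpow_two]; nlinarith) hβ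
    have h2 : a ^ (2 * β) ≤ a ^ m := Real.rpow_le_rpow_of_exponent_le ha1 (le_max_right _ _)
    calc b = κ * (1 + a ^ 2) ^ β := hb
      _ ≤ κ * ((2 : ℝ) ^ β * a ^ m) := by
          refine mul_le_mul_of_nonneg_left (h1.trans ?_) hκ.le
          exact mul_le_mul_of_nonneg_left h2 (by positivity)
      _ = (κ * (2 : ℝ) ^ β) * a ^ m := by ring
      _ ≤ L * a ^ m := mul_le_mul_of_nonneg_right (by rw [hL]; linarith) (by positivity)
  have hT : a ^ 2 ≤ b' ^ 2 := by nlinarith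
  -- confinement on the window
  have hsuppW : ∀ τ ∈ Ioo (-(a ^ 2)) 0, Function.support (curl (u τ)) ⊆ ball (0 : EuclideanSpace ℝ (Fin 3)) b := by
    intro τ hτ
    refine (hsupp τ hτ.2).trans (ball_subset_ball ?_)
    rw [hb]
    refine mul_le_mul_of_nonneg_left (Real.rpow_le_rpow (by positivity) ?_ hβ) hκ.le
    rw [abs_of_neg hτ.2]; linarith [hτ.1]
  have hvolW : ∀ τ ∈ Ioo (-(a ^ 2)) 0, volume (Function.support (curl (u τ))) ≤ V₀ :=
    fun τ hτ => (hvolτ τ hτ.2).le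
  -- ### window slaving under the `E`-gauge
  have hwin := lintegral_window_energy_le hcl hH hE hC hrepr hωc hV₀t hb'0 hbb' hT hsuppW hvolW
  -- `Λ(a) = K₁ · c b'^{1−ρ} ≤ ofReal (k₁ c L^θ a^{mθ}) < ofReal (ε/4 · a²)`
  have hpow : b' ^ (1 - ρ) ≤ L ^ θ * a ^ (m * θ) := by
    calc b' ^ (1 - ρ) ≤ b' ^ θ := Real.rpow_le_rpow_of_exponent_le hb'1 (le_max_left _ _)
      _ = L ^ θ * (a ^ m) ^ θ := by rw [hb', Real.mul_rpow hL0.le (by positivity)]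
      _ = L ^ θ * a ^ (m * θ) := by rw [← Real.rpow_mul ha0.le]
  have hΛ : K₁ * ENNReal.ofReal ((c : ℝ) * b' ^ (1 - ρ)) ≤ ENNReal.ofReal (k₁ * ((c : ℝ) * L ^ θ) * a ^ (m * θ - 2) * a ^ 2) := by
    rw [← ENNReal.ofReal_toReal hK₁t, ← hk₁, ← ENNReal.ofReal_mul hk₁0]
    refine ENNReal.ofReal_le_ofReal ?_
    have hc0 : (0 : ℝ) ≤ c := c.2
    have e : k₁ * ((c : ℝ) * L ^ θ) * a ^ (m * θ - 2) * a ^ 2 = k₁ * ((c : ℝ) * (L ^ θ * a ^ (m * θ))) := by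
      have : a ^ (m * θ - 2) * a ^ 2 = a ^ (m * θ) := by
        rw [← Real.rpow_two, ← Real.rpow_add ha0]; ring_nf
      calc k₁ * ((c : ℝ) * L ^ θ) * a ^ (m * θ - 2) * a ^ 2 = k₁ * ((c : ℝ) * L ^ θ) * (a ^ (m * θ - 2) * a ^ 2) := by ring
        _ = _ := by rw [this]; ring
    rw [e]
    exact mul_le_mul_of_nonneg_left (mul_le_mul_of_nonneg_left hpow hc0) hk₁0
  have hwin' : ∫⁻ τ in Ioo (-(a ^ 2)) 0, ∫⁻ x, ‖u τ x‖ₑ ^ 2 ≤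
      ENNReal.ofReal (k₁ * ((c : ℝ) * L ^ θ) * a ^ (m * θ - 2) * a ^ 2) := by
    refine le_trans ?_ hΛ
    have : (C : ℝ≥0∞) * V₀ ^ (2 / 3 : ℝ) * ENNReal.ofReal (‖curlCLM‖ ^ 2) * ENNReal.ofReal ((c : ℝ) * b' ^ (1 - ρ)) =
        K₁ * ENNReal.ofReal ((c : ℝ) * b' ^ (1 - ρ)) := by rw [hK₁]
    rw [← this]; exact hwin
  -- ### Chebyshev in time on `W = (−a², −a²/2)`
  set W : Set ℝ := Ioo (-(a ^ 2)) (-(a ^ 2 / 2)) with hW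
  have hWsub : W ⊆ Ioo (-(a ^ 2)) 0 := Ioo_subset_Ioo le_rfl (by nlinarith)
  set F : ℝ → ℝ≥0∞ := fun s => ∫⁻ x, ‖u s x‖ₑ ^ 2 with hF
  have hFm : AEMeasurable F (volume.restrict W) := by
    have hsub : W ×ˢ (univ : Set (EuclideanSpace ℝ (Fin 3))) ⊆ Iio (0 : ℝ) ×ˢ (univ : Set (EuclideanSpace ℝ (Fin 3))) :=
      prod_mono (fun s hs => lt_trans hs.2 (by nlinarith)) le_rfl
    have h1 : AEStronglyMeasurable (uncurry u)
        (((volume : Measure ℝ).restrict W).prod (volume : Measure (EuclideanSpace ℝ (Fin 3)))) := by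
      have := hum.mono_measure (Measure.restrict_mono hsub le_rfl)
      rwa [Measure.volume_eq_prod, ← Measure.prod_restrict, Measure.restrict_univ] at this
    exact (h1.aemeasurable.enorm.pow_const 2).lintegral_prod_right'
  have hmarkov : ENNReal.ofReal ε * volume.restrict W {s | ENNReal.ofReal ε ≤ F s} ≤
      ENNReal.ofReal (k₁ * ((c : ℝ) * L ^ θ) * a ^ (m * θ - 2) * a ^ 2) :=
    calc ENNReal.ofReal ε * volume.restrict W {s | ENNReal.ofReal ε ≤ F s}
        ≤ ∫⁻ s in W, F s := mul_meas_ge_le_lintegral₀ hFm _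
      _ ≤ ∫⁻ s in Ioo (-(a ^ 2)) 0, F s := lintegral_mono_set hWsub
      _ ≤ _ := hwin'
  -- ### conclusion: the good set has positive measure
  intro h0
  -- `W ⊆ good ∪ {ε ≤ F}`
  have hcover : W ⊆ {s : ℝ | s < -N ∧ ∫⁻ x, ‖u s x‖ₑ ^ 2 ≤ ENNReal.ofReal ε} ∪ (W ∩ {s | ENNReal.ofReal ε ≤ F s}) := by
    intro s hs
    by_cases hFs : F s ≤ ENNReal.ofReal ε
    · left
      refine ⟨?_, hFs⟩
      have := hs.2; linarith
    · right
      exact ⟨hs, (not_le.1 hFs).le⟩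
  have hvolW : volume W = ENNReal.ofReal (a ^ 2 / 2) := by
    rw [hW, Real.volume_Ioo]; congr 1; ring
  have hle : volume W ≤ volume.restrict W {s | ENNReal.ofReal ε ≤ F s} := by
    calc volume W ≤ volume ({s : ℝ | s < -N ∧ ∫⁻ x, ‖u s x‖ₑ ^ 2 ≤ ENNReal.ofReal ε}) +
          volume (W ∩ {s | ENNReal.ofReal ε ≤ F s}) := (measure_mono hcover).trans (measure_union_le _ _)
      _ = volume (W ∩ {s | ENNReal.ofReal ε ≤ F s}) := by rw [h0, zero_add]
      _ ≤ volume.restrict W {s | ENNReal.ofReal ε ≤ F s} := by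
          rw [inter_comm]; exact Measure.le_restrict_apply _ _
  have hfinal : ENNReal.ofReal ε * ENNReal.ofReal (a ^ 2 / 2) ≤
      ENNReal.ofReal (k₁ * ((c : ℝ) * L ^ θ) * a ^ (m * θ - 2) * a ^ 2) :=
    calc ENNReal.ofReal ε * ENNReal.ofReal (a ^ 2 / 2) = ENNReal.ofReal ε * volume W := by rw [hvolW]
      _ ≤ ENNReal.ofReal ε * volume.restrict W {s | ENNReal.ofReal ε ≤ F s} := mul_le_mul' le_rfl hle
      _ ≤ _ := hmarkov
  rw [← ENNReal.ofReal_mul hε.le] at hfinal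
  have hreal := (ENNReal.ofReal_le_ofReal_iff (by positivity)).1 hfinal
  -- but `k₁ c L^θ a^{mθ−2} < ε/4`, so the right side is `< ε a²/4 < ε a²/2`
  have : k₁ * ((c : ℝ) * L ^ θ) * a ^ (m * θ - 2) * a ^ 2 < ε * (a ^ 2 / 2) := by
    have ha2 : 0 < a ^ 2 := by positivity
    nlinarith [haε, ha2]
  linarith

end CompactVortex

end Summit.NavierStokesRegularity.NavierStokesRegularity.Theorems.PowerGaugeEulerLiouville
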